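import Summits.Ventures.PercRepro.C041ZonePortCaseIVA

/-!
# The zone port problem of THEOREM R: CASE (iv), two edges of the same side at pure-type gates (p6, gen 24)

Setting of `C041ZonePortCaseIVA` (mine-3, C-041.md §3 (iv) / §6 (c), general multiplicities).  Two DISTINCT 1-edges
`e, e′` at gates of pure type `{1}` — at two different gates, or at ONE gate carrying several 1-edges (the paper's
`W₁ ≥ 3`): every colouring with one of them red has weight `≥ 1` (a red edge at a pure-type gate gives the opposite
side by THE KEY FACT), the colouring with both blue has weight `≥ −2` and injects into each of the three others by
reddening, so `Φ ≥ #RR + #RB + #BR − 2·#BB ≥ 0` (`phi_nonneg_of_pure_gates_same₁`; `_same₂` for two 2-edges).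
With cases (ii), (iii) and the mixed case of (iv) this leaves exactly case (v) for THE LEMMA: a UNIQUE gate,
switchable, of pure type, carrying a SINGLE terminal edge.
-/

namespace PercRepro

namespace ZonePort

namespace Problem

open Finset

variable {V E : Type*} {P : Problem V E}

section Sums

variable [Fintype E] [DecidableEq E] [DecidableEq V]

open Classical in
/-- **CASE (iv), two 1-edges at type-`{1}` gates**: `0 ≤ Φ`; the closed colouring injects into the three open ones. -/
theorem phi_nonneg_of_pure_gates_same₁ (val : (P.Term → Bool) → Prop)
    (hval : ∀ x e, val x → val (Function.update x e true))
    {e e' : P.Term} (hCe : P.IsGate (P.tz e.1)) (hCe' : P.IsGate (P.tz e'.1))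
    (he : P.ts e.1 = false) (he' : P.ts e'.1 = false) (hne : e ≠ e')
    (hpe : P.Pure₁ (P.tz e.1)) (hpe' : P.Pure₁ (P.tz e'.1)) :
    0 ≤ ∑ x : P.Term → Bool, if P.Adm x ∧ val x then P.weight x else 0 := by
  rw [sum_split_four val e e']
  set RR := univ.filter fun x : P.Term → Bool => (P.Adm x ∧ val x) ∧ x e = true ∧ x e' = true with hRR
  set RB := univ.filter fun x : P.Term → Bool => (P.Adm x ∧ val x) ∧ x e = true ∧ x e' = false with hRB
  set BR := univ.filter fun x : P.Term → Bool => (P.Adm x ∧ val x) ∧ x e = false ∧ x e' = true with hBR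
  set BB := univ.filter fun x : P.Term → Bool => (P.Adm x ∧ val x) ∧ x e = false ∧ x e' = false with hBB
  have hRRw : 1 * (RR.card : ℤ) ≤ ∑ x ∈ RR, P.weight x := by
    apply card_mul_le_sum_of_forall
    intro x hx
    rw [hRR, mem_filter] at hx
    exact one_le_weight_of_good (Or.inr (good₂_of_red_pure_gate hCe he hpe hx.2.2.1))
  have hRBw : 1 * (RB.card : ℤ) ≤ ∑ x ∈ RB, P.weight x := by
    apply card_mul_le_sum_of_forall
    intro x hx
    rw [hRB, mem_filter] at hx
    exact one_le_weight_of_good (Or.inr (good₂_of_red_pure_gate hCe he hpe hx.2.2.1))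
  have hBRw : 1 * (BR.card : ℤ) ≤ ∑ x ∈ BR, P.weight x := by
    apply card_mul_le_sum_of_forall
    intro x hx
    rw [hBR, mem_filter] at hx
    exact one_le_weight_of_good (Or.inr (good₂_of_red_pure_gate hCe' he' hpe' hx.2.2.2))
  have hBBw : -2 * (BB.card : ℤ) ≤ ∑ x ∈ BB, P.weight x :=
    card_mul_le_sum_of_forall fun x _ => neg_two_le_weight x
  -- the three injections of the closed colouring
  have hBB_RR : BB.card ≤ RR.card := by
    refine card_le_card_of_injOn
      (fun x => Function.update (Function.update x e true) e' true) ?_ ?_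
    · intro x hx
      rw [hBB, coe_filter] at hx
      rw [hRR, coe_filter]
      refine ⟨mem_univ _, ⟨adm_update_true (adm_update_true hx.2.1.1 e) e',
        hval _ e' (hval x e hx.2.1.2)⟩, ?_, ?_⟩
      · show Function.update (Function.update x e true) e' true e = true
        rw [Function.update_of_ne hne]
        exact Function.update_self ..
      · show Function.update (Function.update x e true) e' true e' = true
        exact Function.update_self ..
    · intro x hx y hy hxy
      rw [hBB, coe_filter] at hx hy
      exact update2_injOn e e' false false ⟨hx.2.2.1, hx.2.2.2⟩ ⟨hy.2.2.1, hy.2.2.2⟩ hxy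
  have hBB_RB : BB.card ≤ RB.card := by
    refine card_le_card_of_injOn (fun x => Function.update x e true) ?_ ?_
    · intro x hx
      rw [hBB, coe_filter] at hx
      rw [hRB, coe_filter]
      refine ⟨mem_univ _, ⟨adm_update_true hx.2.1.1 e, hval x e hx.2.1.2⟩, ?_, ?_⟩
      · show Function.update x e true e = true
        exact Function.update_self ..
      · show Function.update x e true e' = false
        rw [Function.update_of_ne hne.symm]
        exact hx.2.2.2
    · intro x hx y hy hxy
      rw [hBB, coe_filter] at hx hy
      exact update_injOn e true false hx.2.2.1 hy.2.2.1 hxy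
  have hBB_BR : BB.card ≤ BR.card := by
    refine card_le_card_of_injOn (fun x => Function.update x e' true) ?_ ?_
    · intro x hx
      rw [hBB, coe_filter] at hx
      rw [hBR, coe_filter]
      refine ⟨mem_univ _, ⟨adm_update_true hx.2.1.1 e', hval x e' hx.2.1.2⟩, ?_, ?_⟩
      · show Function.update x e' true e = false
        rw [Function.update_of_ne hne]
        exact hx.2.2.1
      · show Function.update x e' true e' = true
        exact Function.update_self ..
    · intro x hx y hy hxy
      rw [hBB, coe_filter] at hx hy
      exact update_injOn e' true false hx.2.2.2 hy.2.2.2 hxy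
  have h1 : (BB.card : ℤ) ≤ RR.card := by exact_mod_cast hBB_RR
  have h2 : (BB.card : ℤ) ≤ RB.card := by exact_mod_cast hBB_RB
  have h3 : (BB.card : ℤ) ≤ BR.card := by exact_mod_cast hBB_BR
  linarith

open Classical in
/-- **CASE (iv), two 2-edges at type-`{2}` gates**: `0 ≤ Φ`. -/
theorem phi_nonneg_of_pure_gates_same₂ (val : (P.Term → Bool) → Prop)
    (hval : ∀ x e, val x → val (Function.update x e true))
    {f f' : P.Term} (hCf : P.IsGate (P.tz f.1)) (hCf' : P.IsGate (P.tz f'.1))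
    (hf : P.ts f.1 = true) (hf' : P.ts f'.1 = true) (hne : f ≠ f')
    (hpf : P.Pure₂ (P.tz f.1)) (hpf' : P.Pure₂ (P.tz f'.1)) :
    0 ≤ ∑ x : P.Term → Bool, if P.Adm x ∧ val x then P.weight x else 0 := by
  rw [sum_split_four val f f']
  set RR := univ.filter fun x : P.Term → Bool => (P.Adm x ∧ val x) ∧ x f = true ∧ x f' = true with hRR
  set RB := univ.filter fun x : P.Term → Bool => (P.Adm x ∧ val x) ∧ x f = true ∧ x f' = false with hRB
  set BR := univ.filter fun x : P.Term → Bool => (P.Adm x ∧ val x) ∧ x f = false ∧ x f' = true with hBR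
  set BB := univ.filter fun x : P.Term → Bool => (P.Adm x ∧ val x) ∧ x f = false ∧ x f' = false with hBB
  have hRRw : 1 * (RR.card : ℤ) ≤ ∑ x ∈ RR, P.weight x := by
    apply card_mul_le_sum_of_forall
    intro x hx
    rw [hRR, mem_filter] at hx
    exact one_le_weight_of_good (Or.inl (good₁_of_red_pure_gate hCf hf hpf hx.2.2.1))
  have hRBw : 1 * (RB.card : ℤ) ≤ ∑ x ∈ RB, P.weight x := by
    apply card_mul_le_sum_of_forall
    intro x hx
    rw [hRB, mem_filter] at hx
    exact one_le_weight_of_good (Or.inl (good₁_of_red_pure_gate hCf hf hpf hx.2.2.1))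
  have hBRw : 1 * (BR.card : ℤ) ≤ ∑ x ∈ BR, P.weight x := by
    apply card_mul_le_sum_of_forall
    intro x hx
    rw [hBR, mem_filter] at hx
    exact one_le_weight_of_good (Or.inl (good₁_of_red_pure_gate hCf' hf' hpf' hx.2.2.2))
  have hBBw : -2 * (BB.card : ℤ) ≤ ∑ x ∈ BB, P.weight x :=
    card_mul_le_sum_of_forall fun x _ => neg_two_le_weight x
  have hBB_RR : BB.card ≤ RR.card := by
    refine card_le_card_of_injOn
      (fun x => Function.update (Function.update x f true) f' true) ?_ ?_
    · intro x hx
      rw [hBB, coe_filter] at hx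
      rw [hRR, coe_filter]
      refine ⟨mem_univ _, ⟨adm_update_true (adm_update_true hx.2.1.1 f) f',
        hval _ f' (hval x f hx.2.1.2)⟩, ?_, ?_⟩
      · show Function.update (Function.update x f true) f' true f = true
        rw [Function.update_of_ne hne]
        exact Function.update_self ..
      · show Function.update (Function.update x f true) f' true f' = true
        exact Function.update_self ..
    · intro x hx y hy hxy
      rw [hBB, coe_filter] at hx hy
      exact update2_injOn f f' false false ⟨hx.2.2.1, hx.2.2.2⟩ ⟨hy.2.2.1, hy.2.2.2⟩ hxy
  have hBB_RB : BB.card ≤ RB.card := by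
    refine card_le_card_of_injOn (fun x => Function.update x f true) ?_ ?_
    · intro x hx
      rw [hBB, coe_filter] at hx
      rw [hRB, coe_filter]
      refine ⟨mem_univ _, ⟨adm_update_true hx.2.1.1 f, hval x f hx.2.1.2⟩, ?_, ?_⟩
      · show Function.update x f true f = true
        exact Function.update_self ..
      · show Function.update x f true f' = false
        rw [Function.update_of_ne hne.symm]
        exact hx.2.2.2
    · intro x hx y hy hxy
      rw [hBB, coe_filter] at hx hy
      exact update_injOn f true false hx.2.2.1 hy.2.2.1 hxy
  have hBB_BR : BB.card ≤ BR.card := by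
    refine card_le_card_of_injOn (fun x => Function.update x f' true) ?_ ?_
    · intro x hx
      rw [hBB, coe_filter] at hx
      rw [hBR, coe_filter]
      refine ⟨mem_univ _, ⟨adm_update_true hx.2.1.1 f', hval x f' hx.2.1.2⟩, ?_, ?_⟩
      · show Function.update x f' true f = false
        rw [Function.update_of_ne hne]
        exact hx.2.2.1
      · show Function.update x f' true f' = true
        exact Function.update_self ..
    · intro x hx y hy hxy
      rw [hBB, coe_filter] at hx hy
      exact update_injOn f' true false hx.2.2.2 hy.2.2.2 hxy
  have h1 : (BB.card : ℤ) ≤ RR.card := by exact_mod_cast hBB_RR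
  have h2 : (BB.card : ℤ) ≤ RB.card := by exact_mod_cast hBB_RB
  have h3 : (BB.card : ℤ) ≤ BR.card := by exact_mod_cast hBB_BR
  linarith

open Classical in
/-- **CASE (iv), `Φ∨`, two 1-edges at type-`{1}` gates.** -/
theorem phiOr_nonneg_of_pure_gates_same₁ {e e' : P.Term} (hCe : P.IsGate (P.tz e.1))
    (hCe' : P.IsGate (P.tz e'.1)) (he : P.ts e.1 = false) (he' : P.ts e'.1 = false) (hne : e ≠ e')
    (hpe : P.Pure₁ (P.tz e.1)) (hpe' : P.Pure₁ (P.tz e'.1)) : 0 ≤ P.phiOr := by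
  unfold phiOr
  convert phi_nonneg_of_pure_gates_same₁ (fun x => P.X₁ x ∨ P.X₂ x) valOr_update hCe hCe' he he' hne hpe hpe'
    using 3

open Classical in
/-- **CASE (iv), `Φ∧`, two 1-edges at type-`{1}` gates.** -/
theorem phiAnd_nonneg_of_pure_gates_same₁ {e e' : P.Term} (hCe : P.IsGate (P.tz e.1))
    (hCe' : P.IsGate (P.tz e'.1)) (he : P.ts e.1 = false) (he' : P.ts e'.1 = false) (hne : e ≠ e')
    (hpe : P.Pure₁ (P.tz e.1)) (hpe' : P.Pure₁ (P.tz e'.1)) : 0 ≤ P.phiAnd := by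
  unfold phiAnd
  convert phi_nonneg_of_pure_gates_same₁ (fun x => P.X₁ x ∧ P.X₂ x) valAnd_update hCe hCe' he he' hne hpe hpe'
    using 3

open Classical in
/-- **CASE (iv), `Φ∨`, two 2-edges at type-`{2}` gates.** -/
theorem phiOr_nonneg_of_pure_gates_same₂ {f f' : P.Term} (hCf : P.IsGate (P.tz f.1))
    (hCf' : P.IsGate (P.tz f'.1)) (hf : P.ts f.1 = true) (hf' : P.ts f'.1 = true) (hne : f ≠ f')
    (hpf : P.Pure₂ (P.tz f.1)) (hpf' : P.Pure₂ (P.tz f'.1)) : 0 ≤ P.phiOr := by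
  unfold phiOr
  convert phi_nonneg_of_pure_gates_same₂ (fun x => P.X₁ x ∨ P.X₂ x) valOr_update hCf hCf' hf hf' hne hpf hpf'
    using 3

open Classical in
/-- **CASE (iv), `Φ∧`, two 2-edges at type-`{2}` gates.** -/
theorem phiAnd_nonneg_of_pure_gates_same₂ {f f' : P.Term} (hCf : P.IsGate (P.tz f.1))
    (hCf' : P.IsGate (P.tz f'.1)) (hf : P.ts f.1 = true) (hf' : P.ts f'.1 = true) (hne : f ≠ f')
    (hpf : P.Pure₂ (P.tz f.1)) (hpf' : P.Pure₂ (P.tz f'.1)) : 0 ≤ P.phiAnd := by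
  unfold phiAnd
  convert phi_nonneg_of_pure_gates_same₂ (fun x => P.X₁ x ∧ P.X₂ x) valAnd_update hCf hCf' hf hf' hne hpf hpf'
    using 3

end Sums

end Problem

end ZonePort

end PercRepro
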